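import Literature.NumberTheory.LFunctions.WeilArchimedeanMoments
import Literature.NumberTheory.LFunctions.RiemannSiegelStirling

/-!
# Stub `stub_archBathtub` of line `Sketch`, crux `WeilComb.CombShapePositivity` — siege attempt k4
(item stmt-RiemannHypothesis-11229, route route-RiemannHypothesis-WeilComb; variation: DIRECT INTEGRAL
ESTIMATE WITH INTERVAL BOUNDS)

For a Weil test `g` with `L = ‖g‖₁ > 0` (`weilNorm1`), `N = ‖g‖₂²` (`weilNorm2Sq`) and `2L² ≤ πN`:

`Re W_∞(g ⋆ g̃) ≥ N (log(N/(2L²)) − 1) − (21/(5π)) L²`.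

Proof (independent of the Stirling formula for `arg Γ` used in
`WeilCombCombShapePositivityStubArchBathtub.lean`; here the digamma integral is bounded DIRECTLY):

* `Re W_∞(g ⋆ g̃) = (1/2π) ∫ G ρ − N log π`, `G(u) = |ĝ(1/2+iu)|²`, `ρ(u) = Re ψ(1/4 + iu/2)`
  (`weilArchIntegral_weilConv_weilReflect`, `weilConv_weilReflect_apply_zero`);
* bathtub: `0 ≤ G ≤ L²` (`norm_weilMellin_half_line_le`), `∫ G = 2πN` (Plancherel,
  `integral_norm_sq_weilMellin_half_line`), `ρ` even and increasing in `|u|` (`reDigammaQuarter_mono`);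
  with `L² T = πN` the pointwise inequality `1_{[−T,T]} L² (ρ − ρ(T)) ≤ G (ρ − ρ(T))` integrates to
  `L² ∫_{−T}^{T} ρ ≤ ∫ G ρ`;
* the digamma integral by INTERVAL BOUNDS: `ρ ≥ ρ(0) ≥ −4.22745354` on `[0, 1]`
  (`re_digamma_one_quarter_ge`), `ρ ≥ ρ(1) ≥ ρ(0) + Σ_{m<4} 2/(l_m(l_m² + 1))` on `[1, 2]`
  (`sum_digammaTerm_le`, `l_m = 2m + 1/2`), and on `[2, T]` the pointwise second-order Stirling bound
  `ρ(u) ≥ log(u/2) − (1/2 + π/3)/u² − 4/(3u³)` (`abs_re_digamma_sub_log_norm_add_re_le` at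
  `w = 1/4 + iu/2`: `‖w‖ ≥ u/2`, `Re 1/(2w) = (1/2)/(1/4 + u²) ≤ 1/(2u²)`), whose primitive
  `u log(u/2) − u + (1/2 + π/3)/u + 2/(3u²)` gives `∫₂^T ρ ≥ T log(T/2) − T + 19/12 − π/6`; altogether
  `∫_{−T}^{T} ρ = 2∫₀^T ρ ≥ 2T(log(T/2) − 1) − 42/5` for `T ≥ 2` (margin `0.28`);
* assembly: `(1/2π) L² (2T(log(T/2) − 1) − 42/5) − N log π = N(log(N/(2L²)) − 1) − (21/(5π)) L²` at
  `T = πN/L² ≥ 2`.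
-/

noncomputable section

-- the sub-problem path RiemannHypothesis/RiemannHypothesis duplicates a namespace (D-0017)
set_option linter.dupNamespace false

open scoped BigOperators ComplexConjugate
open Complex MeasureTheory Set

namespace Summit.RiemannHypothesis.RiemannHypothesis.Theorems.WeilCombBohrFejerIntervalK4

open Literature.NumberTheory.LFunctions
open Literature.Analysis.SpecialFunctions (reDigammaQuarter reDigammaQuarter_even
  reDigammaQuarter_mono reDigammaQuarter_zero_le continuous_reDigammaQuarter digammaTerm digammaNode
  sum_digammaTerm_le reDigammaQuarter_zero re_digamma_one_quarter_ge)

/-! ### Interval bounds for the weight `ρ(u) = Re ψ(1/4 + iu/2)` -/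

/-- Pointwise second-order Stirling minorant on `[2, ∞)`:
`log(u/2) − (1/2 + π/3)/u² − 4/(3u³) ≤ Re ψ(1/4 + iu/2)` (from
`|Re ψ(w) − log ‖w‖ + Re 1/(2w)| ≤ 1/(6|Im w|³) + π/(12 (Im w)²)` at `w = 1/4 + iu/2`, `‖w‖ ≥ u/2`,
`Re 1/(2w) = (1/2)/(1/4 + u²) ≤ 1/(2u²)`). [folklore] -/
theorem reDigammaQuarter_ge_log_sub {u : ℝ} (hu : 2 ≤ u) :
    Real.log (u / 2) - (1 / 2 + Real.pi / 3) / u ^ 2 - 4 / (3 * u ^ 3) ≤ reDigammaQuarter u := by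
  have hu0 : 0 < u := by linarith
  set w : ℂ := 1 / 4 + u / 2 * I with hw
  have hwre : w.re = 1 / 4 := by simp [hw]
  have hwim : w.im = u / 2 := by simp [hw]
  have hre : 0 < w.re := by rw [hwre]; norm_num
  have him : w.im ≠ 0 := by rw [hwim]; positivity
  have h := Literature.NumberTheory.LFunctions.Complex.abs_re_digamma_sub_log_norm_add_re_le hre him
  rw [hwim] at h
  have hρ : (digamma w).re = reDigammaQuarter u := by simp [hw, reDigammaQuarter]
  rw [hρ] at h
  -- `‖w‖ ≥ u/2`
  have hnorm : u / 2 ≤ ‖w‖ := by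
    have := Complex.abs_im_le_norm w
    rwa [hwim, abs_of_pos (by positivity : (0 : ℝ) < u / 2)] at this
  have hlog : Real.log (u / 2) ≤ Real.log ‖w‖ := Real.log_le_log (by positivity) hnorm
  -- `Re 1/(2w) = (1/2)/(1/4 + u²) ≤ 1/(2u²)`
  have h2w : 2 * w = ((1 / 2 : ℝ) : ℂ) + (u : ℂ) * I := by
    rw [hw]; push_cast; ring
  have hinv : (1 / (2 * w)).re = (1 / 2) / ((1 / 2) ^ 2 + u ^ 2) := by
    rw [one_div, Complex.inv_re, h2w, Complex.normSq_add_mul_I]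
    simp
  have hinv_le : (1 / (2 * w)).re ≤ (1 / 2) / u ^ 2 := by
    rw [hinv]
    exact div_le_div_of_nonneg_left (by norm_num) (by positivity) (by nlinarith)
  -- the error term
  have herr : 1 / (6 * |u / 2| ^ 3) + Real.pi / (12 * (u / 2) ^ 2) =
      4 / (3 * u ^ 3) + (Real.pi / 3) / u ^ 2 := by
    rw [abs_of_pos (by positivity : (0 : ℝ) < u / 2)]
    field_simp
    ring
  rw [herr] at h
  have h' := (abs_le.1 h).1
  have e : (1 / 2 + Real.pi / 3) / u ^ 2 = (1 / 2) / u ^ 2 + (Real.pi / 3) / u ^ 2 := by ring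
  rw [e]
  linarith

/-- The explicit minorant integrates on `[2, T]` to at least `T log(T/2) − T + 19/12 − π/6`
(primitive `u log(u/2) − u + (1/2 + π/3)/u + 2/(3u²)`, the positive boundary terms at `T` dropped). [folklore] -/
theorem integral_log_sub_ge {T : ℝ} (hT : 2 ≤ T) :
    T * Real.log (T / 2) - T + 19 / 12 - Real.pi / 6 ≤
      ∫ u in (2 : ℝ)..T, (Real.log (u / 2) - (1 / 2 + Real.pi / 3) / u ^ 2 - 4 / (3 * u ^ 3)) := by
  set a : ℝ := 1 / 2 + Real.pi / 3 with ha
  have ha0 : 0 < a := by rw [ha]; positivity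
  set P : ℝ → ℝ := fun u => u * Real.log (u / 2) - u + a * u⁻¹ + 2 / 3 * (u ^ 2)⁻¹ with hP
  have hderiv : ∀ x ∈ uIcc (2 : ℝ) T,
      HasDerivAt P (Real.log (x / 2) - a / x ^ 2 - 4 / (3 * x ^ 3)) x := by
    intro x hx
    rw [uIcc_of_le hT] at hx
    have hx0 : 0 < x := by linarith [hx.1]
    have hx2 : x / 2 ≠ 0 := by positivity
    have h1 : HasDerivAt (fun y : ℝ => y / 2) (1 / 2) x := by
      simpa using (hasDerivAt_id x).div_const (2 : ℝ)
    have hlog : HasDerivAt (fun y : ℝ => Real.log (y / 2)) ((1 / 2) / (x / 2)) x := h1.log hx2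
    have hmul : HasDerivAt (fun y : ℝ => y * Real.log (y / 2))
        (1 * Real.log (x / 2) + x * ((1 / 2) / (x / 2))) x := (hasDerivAt_id' x).mul hlog
    have hall : HasDerivAt (fun y : ℝ => y * Real.log (y / 2) - y + a * y⁻¹ + 2 / 3 * (y ^ 2)⁻¹)
        (1 * Real.log (x / 2) + x * ((1 / 2) / (x / 2)) - 1 + a * (-(x ^ 2)⁻¹) +
          2 / 3 * (-(↑(2 : ℕ) * x ^ (2 - 1)) / (x ^ 2) ^ 2)) x :=
      ((hmul.sub (hasDerivAt_id' x)).add ((hasDerivAt_inv hx0.ne').const_mul a)).add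
        (((hasDerivAt_pow 2 x).inv (by positivity)).const_mul (2 / 3))
    refine hall.congr_deriv ?_
    have hx' : x ≠ 0 := hx0.ne'
    simp only [Nat.cast_ofNat, Nat.add_one_sub_one, pow_one]
    field_simp
    ring
  have hint : IntervalIntegrable
      (fun x : ℝ => Real.log (x / 2) - a / x ^ 2 - 4 / (3 * x ^ 3)) volume 2 T := by
    refine ContinuousOn.intervalIntegrable ?_
    rw [uIcc_of_le hT]
    intro x hx
    have hx0 : 0 < x := by linarith [hx.1]
    have hx0' : x ≠ 0 := hx0.ne'
    have hx2 : x / 2 ≠ 0 := by positivity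
    exact ContinuousAt.continuousWithinAt (by fun_prop (disch := positivity))
  rw [intervalIntegral.integral_eq_sub_of_hasDerivAt hderiv hint]
  have hT0 : 0 < T := by linarith
  have hP2 : P 2 = -2 + a / 2 + 1 / 6 := by
    simp only [hP]
    norm_num
    ring
  have hPT : T * Real.log (T / 2) - T ≤ P T := by
    simp only [hP]
    have h1 : 0 ≤ a * T⁻¹ := by positivity
    have h2 : 0 ≤ 2 / 3 * (T ^ 2)⁻¹ := by positivity
    linarith
  rw [hP2]
  linarith

/-- **Direct lower bound for the digamma integral.** For `T ≥ 2`: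
`2T (log(T/2) − 1) − 42/5 ≤ ∫_{−T}^{T} Re ψ(1/4 + iu/2) du`, by evenness and the interval bounds
`ρ ≥ ρ(0) ≥ −4.22745354` on `[0,1]`, `ρ ≥ ρ(1) ≥ ρ(0) + Σ_{m<4} 2/(l_m(l_m²+1))` on `[1,2]`, and the
Stirling minorant on `[2,T]`. [folklore] -/
theorem integral_reDigammaQuarter_ge {T : ℝ} (hT : 2 ≤ T) :
    2 * T * (Real.log (T / 2) - 1) - 42 / 5 ≤ ∫ u in (-T)..T, reDigammaQuarter u := by
  have hc : Continuous reDigammaQuarter := continuous_reDigammaQuarter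
  have hii : ∀ a b : ℝ, IntervalIntegrable reDigammaQuarter volume a b := fun a b =>
    hc.intervalIntegrable a b
  -- evenness
  have hneg : ∫ u in (-T)..0, reDigammaQuarter u = ∫ u in (0 : ℝ)..T, reDigammaQuarter u := by
    have h := intervalIntegral.integral_comp_neg reDigammaQuarter (a := 0) (b := T)
    simp only [neg_zero, reDigammaQuarter_even] at h
    exact h.symm
  have hsplit : ∫ u in (-T)..T, reDigammaQuarter u = 2 * ∫ u in (0 : ℝ)..T, reDigammaQuarter u := by
    rw [← intervalIntegral.integral_add_adjacent_intervals (hii (-T) 0) (hii 0 T), hneg]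
    ring
  have hsplit' : ∫ u in (0 : ℝ)..T, reDigammaQuarter u =
      (∫ u in (0 : ℝ)..1, reDigammaQuarter u) + (∫ u in (1 : ℝ)..2, reDigammaQuarter u) +
        ∫ u in (2 : ℝ)..T, reDigammaQuarter u := by
    rw [intervalIntegral.integral_add_adjacent_intervals (hii 0 1) (hii 1 2),
      intervalIntegral.integral_add_adjacent_intervals (hii 0 2) (hii 2 T)]
  -- `[0, 1]`
  have h01 : reDigammaQuarter 0 ≤ ∫ u in (0 : ℝ)..1, reDigammaQuarter u := by
    have h := intervalIntegral.integral_mono_on (by norm_num : (0 : ℝ) ≤ 1) intervalIntegrable_const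
      (hii 0 1) (fun u _ => reDigammaQuarter_zero_le u) (f := fun _ => reDigammaQuarter 0)
    rwa [intervalIntegral.integral_const, sub_zero, one_smul] at h
  -- `[1, 2]`
  have h12 : reDigammaQuarter 1 ≤ ∫ u in (1 : ℝ)..2, reDigammaQuarter u := by
    have h := intervalIntegral.integral_mono_on (by norm_num : (1 : ℝ) ≤ 2) intervalIntegrable_const
      (hii 1 2) (f := fun _ => reDigammaQuarter 1) (fun u hu => reDigammaQuarter_mono (by
        rw [abs_one, abs_of_nonneg (by linarith [hu.1])]; exact hu.1))
    rwa [intervalIntegral.integral_const, show (2 : ℝ) - 1 = 1 by norm_num, one_smul] at h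
  -- `ρ(1) ≥ ρ(0) + Σ_{m<4} f_{l_m}(1)`
  have hρ1 : reDigammaQuarter 0 + (16 / 5 + 16 / 145 + 16 / 765 + 16 / 2249) ≤ reDigammaQuarter 1 := by
    have h := sum_digammaTerm_le 4 1
    have hs : ∑ m ∈ Finset.range 4, digammaTerm (digammaNode m) 1 =
        16 / 5 + 16 / 145 + 16 / 765 + 16 / 2249 := by
      simp only [Finset.sum_range_succ, Finset.sum_range_zero, digammaTerm, digammaNode]
      norm_num
    rwa [hs] at h
  -- `ρ(0) ≥ −4.22745354`
  have hρ0 : (-4.22745354 : ℝ) ≤ reDigammaQuarter 0 := by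
    rw [reDigammaQuarter_zero]
    exact re_digamma_one_quarter_ge
  -- `[2, T]`
  have h2T : T * Real.log (T / 2) - T + 19 / 12 - Real.pi / 6 ≤ ∫ u in (2 : ℝ)..T, reDigammaQuarter u := by
    refine (integral_log_sub_ge hT).trans ?_
    refine intervalIntegral.integral_mono_on hT ?_ (hii 2 T) fun u hu => reDigammaQuarter_ge_log_sub hu.1
    refine ContinuousOn.intervalIntegrable ?_
    rw [uIcc_of_le hT]
    intro x hx
    have hx0 : 0 < x := by linarith [hx.1]
    have hx0' : x ≠ 0 := hx0.ne'
    have hx2 : x / 2 ≠ 0 := by positivity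
    exact ContinuousAt.continuousWithinAt (by fun_prop (disch := positivity))
  have hpi := Real.pi_lt_d2
  rw [hsplit, hsplit']
  linarith [h01, h12, hρ1, hρ0, h2T, hpi]

/-! ### The bathtub rearrangement -/

/-- **Bathtub rearrangement.** For a Weil test `g` with `L = ‖g‖₁`, `N = ‖g‖₂²`, `T ≥ 0` and
`L² T = πN`: `L² ∫_{−T}^{T} ρ ≤ ∫ |ĝ(1/2+iu)|² ρ(u) du`. Pointwise
`1_{[−T,T]}(u) L² (ρ(u) − ρ(T)) ≤ |ĝ(1/2+iu)|² (ρ(u) − ρ(T))` (`|ĝ|² ≤ L²`, `ρ` increasing in `|u|`),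
and the integrals of the two sides are `L²(∫_{−T}^{T} ρ − 2Tρ(T))` and `∫ |ĝ|²ρ − 2πN ρ(T)`. [folklore] -/
theorem bathtub {g : ℝ → ℂ} (hg : IsWeilTest g) {T : ℝ} (hT0 : 0 ≤ T)
    (hT : weilNorm1 g ^ 2 * T = Real.pi * weilNorm2Sq g) :
    weilNorm1 g ^ 2 * ∫ u in (-T)..T, reDigammaQuarter u ≤
      ∫ u : ℝ, ‖weilMellin g (1 / 2 + u * I)‖ ^ 2 * reDigammaQuarter u := by
  set L2 : ℝ := weilNorm1 g ^ 2 with hL2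
  set G : ℝ → ℝ := fun u => ‖weilMellin g (1 / 2 + u * I)‖ ^ 2 with hG
  have hGi : Integrable G := integrable_norm_sq_weilMellin_half_line hg
  have hPl : ∫ u, G u = 2 * Real.pi * weilNorm2Sq g := integral_norm_sq_weilMellin_half_line hg
  have hGρ : Integrable fun u => G u * reDigammaQuarter u :=
    integrable_norm_sq_weilMellin_mul_reDigammaQuarter hg
  have hGle : ∀ u, G u ≤ L2 := fun u =>
    pow_le_pow_left₀ (norm_nonneg _) (norm_weilMellin_half_line_le hg u) 2
  have hG0 : ∀ u, 0 ≤ G u := fun u => by positivity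
  have hc : Continuous reDigammaQuarter := continuous_reDigammaQuarter
  have hTT : -T ≤ T := by linarith
  -- the two sides
  set k : ℝ → ℝ := (Icc (-T) T).indicator fun u => L2 * (reDigammaQuarter u - reDigammaQuarter T)
    with hk
  set r : ℝ → ℝ := fun u => G u * reDigammaQuarter u - reDigammaQuarter T * G u with hr
  have hkint : IntegrableOn (fun u => L2 * (reDigammaQuarter u - reDigammaQuarter T)) (Icc (-T) T) :=
    (continuous_const.mul (hc.sub continuous_const)).continuousOn.integrableOn_Icc
  have hki : Integrable k := hkint.integrable_indicator measurableSet_Icc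
  have hri : Integrable r := hGρ.sub (hGi.const_mul _)
  -- pointwise comparison
  have hpt : ∀ u, k u ≤ r u := by
    intro u
    by_cases hu : u ∈ Icc (-T) T
    · have hku : k u = L2 * (reDigammaQuarter u - reDigammaQuarter T) := indicator_of_mem hu _
      have hρu : reDigammaQuarter u ≤ reDigammaQuarter T :=
        reDigammaQuarter_mono ((abs_le.2 ⟨hu.1, hu.2⟩).trans (le_abs_self T))
      have hprod : 0 ≤ (L2 - G u) * (reDigammaQuarter T - reDigammaQuarter u) :=
        mul_nonneg (sub_nonneg.2 (hGle u)) (sub_nonneg.2 hρu)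
      rw [hku, hr]
      dsimp only
      nlinarith
    · have hku : k u = 0 := indicator_of_notMem hu _
      have hTu : |T| ≤ |u| := by
        rw [abs_of_nonneg hT0]
        simp only [mem_Icc, not_and_or, not_le] at hu
        rcases hu with h1 | h1
        · linarith [neg_abs_le u]
        · linarith [le_abs_self u]
      have hρu : reDigammaQuarter T ≤ reDigammaQuarter u := reDigammaQuarter_mono hTu
      rw [hku, hr]
      dsimp only
      nlinarith [hG0 u]
  have hmono : ∫ u, k u ≤ ∫ u, r u := integral_mono hki hri hpt
  -- evaluate both integrals
  have hkval : ∫ u, k u = L2 * ((∫ u in (-T)..T, reDigammaQuarter u) - 2 * T * reDigammaQuarter T) := by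
    rw [hk, integral_indicator measurableSet_Icc, integral_Icc_eq_integral_Ioc,
      ← intervalIntegral.integral_of_le hTT, intervalIntegral.integral_const_mul,
      intervalIntegral.integral_sub (hc.intervalIntegrable _ _) intervalIntegrable_const,
      intervalIntegral.integral_const, smul_eq_mul]
    ring
  have hrval : ∫ u, r u = (∫ u, G u * reDigammaQuarter u) - reDigammaQuarter T * (2 * Real.pi * weilNorm2Sq g) := by
    rw [hr, integral_sub hGρ (hGi.const_mul _), integral_const_mul, hPl]
  rw [hkval, hrval] at hmono
  have e : L2 * (2 * T * reDigammaQuarter T) = reDigammaQuarter T * (2 * Real.pi * weilNorm2Sq g) := by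
    rw [hL2]
    linear_combination (2 * reDigammaQuarter T) * hT
  linarith

/-! ### The stub -/

/-- **Stub S3 — bathtub bound for the archimedean diagonal of a Weil test.** For a Weil test `g`
with `0 < ‖g‖₁` and `2‖g‖₁² ≤ π‖g‖₂²`:
`Re W_∞(g ⋆ g̃) ≥ ‖g‖₂² (log(‖g‖₂²/(2‖g‖₁²)) − 1) − (21/(5π)) ‖g‖₁²`
(`Re W_∞(g ⋆ g̃) = (1/2π) ∫ |ĝ|² ρ − ‖g‖₂² log π`, the bathtub rearrangement at `T = π‖g‖₂²/‖g‖₁² ≥ 2`,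
and the direct interval estimate `∫_{−T}^{T} ρ ≥ 2T(log(T/2) − 1) − 42/5`). -/
theorem stub_archBathtub : ∀ g : ℝ → ℂ, IsWeilTest g → 0 < weilNorm1 g →
    2 * weilNorm1 g ^ 2 ≤ Real.pi * weilNorm2Sq g →
    weilNorm2Sq g * (Real.log (weilNorm2Sq g / (2 * weilNorm1 g ^ 2)) - 1) -
        21 / (5 * Real.pi) * weilNorm1 g ^ 2 ≤
      (weilArchTerm (weilConv g (weilReflect g))).re := by
  intro g hg hL hcond
  set N := weilNorm2Sq g with hN
  set L := weilNorm1 g with hL'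
  have hπ : 0 < Real.pi := Real.pi_pos
  have hL2 : 0 < L ^ 2 := by positivity
  have hN0 : 0 < N := by nlinarith
  set T : ℝ := Real.pi * N / L ^ 2 with hT
  have hLT : L ^ 2 * T = Real.pi * N := by rw [hT]; field_simp
  have hT2 : 2 ≤ T := by rw [hT, le_div_iff₀ hL2]; linarith
  set A : ℝ := ∫ u : ℝ, ‖weilMellin g (1 / 2 + u * I)‖ ^ 2 * reDigammaQuarter u with hA
  -- the archimedean term of `g ⋆ g̃` is `(1/2π) A − N log π`
  have harch : (weilArchTerm (weilConv g (weilReflect g))).re =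
      1 / (2 * Real.pi) * A - N * Real.log Real.pi := by
    have e : weilArchTerm (weilConv g (weilReflect g)) =
        ((1 / (2 * Real.pi) * A - N * Real.log Real.pi : ℝ) : ℂ) := by
      unfold weilArchTerm
      rw [weilArchIntegral_weilConv_weilReflect hg, weilConv_weilReflect_apply_zero]
      have hA' : (∫ t : ℝ, ‖weilMellin g (1 / 2 + t * I)‖ ^ 2 * (digamma (1 / 4 + t / 2 * I)).re) = A := rfl
      have hN' : (∫ t : ℝ, ‖g t‖ ^ 2) = N := rfl
      rw [hA', hN']
      push_cast
      ring
    rw [e, Complex.ofReal_re]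
  -- bathtub and the digamma integral
  have hbath : L ^ 2 * ∫ u in (-T)..T, reDigammaQuarter u ≤ A := bathtub hg (by linarith) hLT
  have hdig := integral_reDigammaQuarter_ge hT2
  have hmono : 1 / (2 * Real.pi) * (L ^ 2 * (2 * T * (Real.log (T / 2) - 1) - 42 / 5)) ≤
      1 / (2 * Real.pi) * A :=
    mul_le_mul_of_nonneg_left ((mul_le_mul_of_nonneg_left hdig hL2.le).trans hbath) (by positivity)
  -- algebra: `(1/2π) L² (2T(log(T/2) − 1) − 42/5) = N(log(N/(2L²)) − 1) + N log π − (21/(5π)) L²`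
  have hq : 0 < N / (2 * L ^ 2) := by positivity
  have hlog : Real.log (T / 2) = Real.log Real.pi + Real.log (N / (2 * L ^ 2)) := by
    rw [← Real.log_mul hπ.ne' hq.ne']
    congr 1
    rw [hT]
    field_simp
  have key : 1 / (2 * Real.pi) * (L ^ 2 * (2 * T * (Real.log (T / 2) - 1) - 42 / 5)) =
      N * (Real.log (N / (2 * L ^ 2)) - 1) + N * Real.log Real.pi - 21 / (5 * Real.pi) * L ^ 2 := by
    have e : L ^ 2 * (2 * T * (Real.log (T / 2) - 1) - 42 / 5) =
        2 * (Real.pi * N) * (Real.log (T / 2) - 1) - 42 / 5 * L ^ 2 := by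
      rw [← hLT]; ring
    rw [e, hlog]
    field_simp
    ring
  rw [harch]
  linarith [key, hmono]

end Summit.RiemannHypothesis.RiemannHypothesis.Theorems.WeilCombBohrFejerIntervalK4

end
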